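import Literature.NumberTheory.EllipticCurves.Gamma0CocycleDegeneracyMaps
import Literature.NumberTheory.EllipticCurves.GaloisAction
import Mathlib.AlgebraicGeometry.EllipticCurve.LFunction
import HarnessLib

/-!
# `E[p]` irreducible, `p` odd ⟹ the system `ℓ ↦ a_ℓ(E) mod p` is not Eisenstein (two characters)

Topic `NumberTheory/EllipticCurves`; ONE named fact, statement only (the proved rewritings — the
`algebraMap K K̄` form consumed by the line provers and the narrow one-character form — live in the
sibling `ModPIrreducibleNotEisensteinForms`).
Sibling of `ModPReducibility` (trivial-character case, PROVED in the tree: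
`not_irreducible_of_frobeniusTrace_congr_off_finite` — if `a_ℓ(E) ≡ ℓ + 1 (mod p)` off a finite set
then `E[p]` is reducible; Frobenius density + reduction of torsion, no Brauer–Nesbitt) for the
TWO-CHARACTER Eisenstein systems `a_ℓ(E) ≡ ψ(ℓ) + ℓ φ(ℓ)` of
`Literature.NumberTheory.EllipticCurves.ModularForms.IsEisensteinEigensystem` (Diamond–Shurman
Prop. 5.2.3; `Gamma0CocycleDegeneracyMaps`), with `ψ, φ` Dirichlet characters of ARBITRARY modulus
and values in any field of characteristic `p`. This is the curve-side companion hypothesis of the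
relative Ihara statements of cell `bsd-f2-manin` (es g10, MEMO-es §22; line provers' `hNE′`).

## The printed statements (Darmon–Diamond–Taylor, *Fermat's Last Theorem*, CDM 1995; held copy
`paper:doi-10-4310-cdm-1995-v1995-n1-a1`, read 2026-08-28, PDF page = printed page)

* **Prop. 2.6 (b)** (p. 53 L25–33; proof p. 54 L1–7): "Let `S` be any finite set of primes. … (b) A
  semi-simple mod `ℓ` representation `ρ : G_ℚ → GL_d(k)` is determined by the values of
  `tr ∧^i ρ(Frob_p)` (`i = 1, …, d`) on the primes `p ∉ S` at which `ρ` is unramified. If `ℓ > d`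
  then it is determined by `tr ρ(Frob_p)` on the primes `p ∉ S` at which `ρ` is unramified."
  ("Proof: Combining the Chebotarev density theorem (theorem 2.3) with the continuity of `ρ` … for
  mod `ℓ` representations, this is the Brauer-Nesbitt theorem ([CR], (30.16)).")
* **Prop. 2.8 (a)** (p. 56): "The determinant of `ρ_{E,ℓ}` is `ε`" (Weil pairing).
* **Prop. 2.11 (a)** (p. 57 L1–5): "Suppose `E` has good reduction at `p`. (a) If `ℓ ≠ p`, then
  `ρ_{E,ℓ}` is unramified at `p`, and we have the formula `tr ρ_{E,ℓ}(Frob_p) = p + 1 − #Ē_p(𝔽_p)`."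
* **§3.1, p. 87 L20–21** (mod `ℓ` analogue of Thm. 3.1 (b)–(c); Thm. 3.1 (b), p. 86: "`det(ρ)` is
  the product of `ψ'` with the `ℓ`-adic cyclotomic character `ε`, and `ρ(c)` is conjugate to
  `diag(1, −1)`"): "The representation need not be absolutely irreducible (as in (c)). However if
  `ℓ` is odd, one checks using (b) that `ρ̄` is irreducible if and only if it is absolutely
  irreducible."
* **Lemma 4.12** (p. 120), the model statement: "Suppose that `ℓ` is odd. The representation
  `ρ_𝔪 : G_ℚ → GL₂(𝕋_𝒪/𝔪)` is absolutely irreducible if and only if `𝔪̃` is not Eisenstein.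
  *Proof:* If `ρ_𝔪` is not absolutely irreducible then `ρ_𝔪 ∼ χ₁ ⊕ χ₂` with `N` divisible by the
  product of the conductors of `χ₁` and `χ₂` … Therefore `𝔪̃` is Eisenstein. Conversely if `𝔪̃` is
  Eisenstein then proposition 2.6 implies that `ρ_𝔪` restricted to `G_{ℚ(ζ_{Nℓ})}` has trivial
  semisimplification from which it follows that `ρ_𝔪` is also reducible." (Eisenstein there,
  p. 120 L5–6: "`T_p ≡ p + 1 mod 𝔫` for all `p ≡ 1 mod N`" — the tree's
  `HeckeRing0.primeTo.IsEisenstein`; every weight-`2` Eisenstein system with characters of modulus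
  dividing `N` satisfies it.)

## What is typed, and the reading (DERIVED from the displayed statements; `p` odd)

`not_isEisensteinEigensystem_of_hasIrreducibleModPGaloisRep`: for an elliptic curve `E/ℚ` given by
ANY Weierstrass model `W` (the statement is model-independent: `W.LFunction` and `E[p]` are), an odd
prime `p` with `E[p]` irreducible as an `𝔽_p[G_ℚ]`-module (`WeierstrassCurve.HasIrreducibleModPGaloisRep`,
`GaloisAction`), and any field `F` of characteristic `p`, the system `ℓ ↦ a_ℓ(E)·1_F`
(`a_ℓ(E) = W.LFunction ℓ`, Mathlib's `WeierstrassCurve.LFunction : ArithmeticFunction ℤ`) is not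
`IsEisensteinEigensystem 2`. Reading, in four lines — the first half of the proof of Lemma 4.12 run
for `ρ̄_{E,p}` in place of `ρ_𝔪` and for characters of arbitrary modulus: suppose
`a_ℓ(E) = ψ(ℓ) + ℓ φ(ℓ)` in `F` for all primes `ℓ ∉ S` (`S` finite, `ψ, φ` Dirichlet characters
mod `m ≥ 1` with values in `F`). (1) The values of `ψ, φ` are roots of unity, so both sides live in
the finite field `k = 𝔽_p(ψ, φ) ⊆ F`; `σ := ψ̃ ⊕ ε̄ φ̃ : G_ℚ → GL₂(k)` (`ψ̃, φ̃` through
`Gal(ℚ(ζ_m)/ℚ) ≅ (ℤ/m)^×`, Thm. 2.4; `ε̄` the mod `p` cyclotomic character) is semisimple, unramified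
outside `pm`, with `tr σ(Frob_ℓ) = ψ(ℓ) + ℓ φ(ℓ)`. (2) `ρ̄ := ρ̄_{E,p} ⊗ k` is unramified at the
good `ℓ ≠ p` with `tr ρ̄(Frob_ℓ) = a_ℓ(E)` (Prop. 2.11 (a)), so `tr ρ̄^{ss}` and `tr σ` agree on
`Frob_ℓ` for every `ℓ ∉ S ∪ {p} ∪ {ℓ ∣ m N_E}`. (3) `p > 2 = d`, so Prop. 2.6 (b) gives
`ρ̄^{ss} ≅ σ`: `ρ̄_{E,p}` is not absolutely irreducible. (4) `p` odd and `det ρ̄_{E,p}(c) = ε̄(c) = −1`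
(Prop. 2.8 (a)) put `ρ̄_{E,p}(c) ∼ diag(1, −1)` with `1 ≠ −1`, and then "irreducible iff absolutely
irreducible" (p. 87 L20–21) contradicts `E[p]` irreducible. ∎ NOT covered and NOT asserted: `p = 2`
(there the trace system of a `C₃`-image `ρ̄_{E,2}` IS Eisenstein over `𝔽₄`, `a_ℓ ≡ χ(ℓ) + ℓχ²(ℓ)`;
the `S₃`-image case is true by a Chebotarev argument in `Gal(ℚ(E[2], ζ_m)/ℚ)` that is not the
printed Prop. 2.6 (b), which at `ℓ = d = 2` needs determinants). Tree status: Chebotarev's theorem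
for `ℚ(E[p], ζ_m)` and Brauer–Nesbitt are not in the tree (module docstring of `ModPReducibility`),
so the two-character statement is a named fact; its trivial-character shadow over `𝔽_p` is the
proved `not_irreducible_of_frobeniusTrace_congr_off_finite` (`ModPReducibilityAlmostAllProofs`).

## References

* H. Darmon, F. Diamond, R. Taylor, *Fermat's Last Theorem*, Current Developments in Mathematics
  1995, International Press: Thm. 2.3, Thm. 2.4 (p. 52), Prop. 2.6 (b) (pp. 53–54), Prop. 2.8 (a)
  (p. 56), Prop. 2.11 (a) (p. 57), Thm. 3.1 (b) (p. 86), §3.1 p. 87, Lemma 4.12 (p. 120).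
  [cite: DarmonDiamondTaylor1995, Prop. 2.6 (b), 2.8 (a), 2.11 (a), p. 87, Lemma 4.12]
* F. Diamond, J. Shurman, *A First Course in Modular Forms*, GTM 228 (2005), Prop. 5.2.3 (the
  Eisenstein eigenvalues `ψ(p) + φ(p) p^{k−1}`). [cite: DiamondShurman2005, Prop. 5.2.3 (p. 173)]
-/

noncomputable section

namespace Literature.NumberTheory.EllipticCurves

open Literature.NumberTheory.EllipticCurves.ModularForms

/-- **`E[p]` irreducible with `p` odd ⟹ `ℓ ↦ a_ℓ(E) mod p` is not an Eisenstein system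
`ψ(ℓ) + ℓ φ(ℓ)` over any field of characteristic `p`** (Darmon–Diamond–Taylor 1995: Prop. 2.6 (b)
Chebotarev + Brauer–Nesbitt for `ℓ > d`, Prop. 2.8 (a) `det = ε`, Prop. 2.11 (a)
`tr ρ_{E,ℓ}(Frob_p) = a_p`, p. 87 "if `ℓ` is odd … `ρ̄` is irreducible if and only if it is absolutely
irreducible", and Lemma 4.12 "`ρ_𝔪` … is absolutely irreducible if and only if `𝔪̃` is not
Eisenstein" whose proof is the reading; see the module docstring for the four-line derivation and
its page locators). For every Weierstrass model `W` of an elliptic curve over `ℚ`, every odd prime `p`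
with `E[p]` an irreducible `𝔽_p[G_ℚ]`-module, and every field `F` of characteristic `p`: there are NO
finite set `S`, modulus `m ≥ 1` and Dirichlet characters `ψ, φ` mod `m` with values in `F` such that
`a_ℓ(E) = ψ(ℓ) + ℓ φ(ℓ)` in `F` for all primes `ℓ ∉ S` (`a_ℓ(E) = W.LFunction ℓ`). The case `p = 2`
is excluded (false for `C₃`-image, see the module docstring).
[cite: DarmonDiamondTaylor1995, Prop. 2.6 (b) p. 53, Prop. 2.8 (a) p. 56, Prop. 2.11 (a) p. 57, p. 87, Lemma 4.12 p. 120] -/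
def not_isEisensteinEigensystem_of_hasIrreducibleModPGaloisRep : Prop :=
  ∀ (W : WeierstrassCurve ℚ) [W.IsElliptic] (p : ℕ) [Fact p.Prime], p ≠ 2 →
    W.HasIrreducibleModPGaloisRep p →
    ∀ (F : Type) [Field F] [CharP F p],
      ¬ IsEisensteinEigensystem 2 (fun ℓ : ℕ => ((W.LFunction ℓ : ℤ) : F))

end Literature.NumberTheory.EllipticCurves

end
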